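import Summits.Schanuel.Schanuel.Theorems.SoloInformedDerivativeGcdRadical

/-!
# Dyadic multiplicity classes of an integer polynomial are cut out by integer polynomials

Solo-informed Schanuel seat, session s191 (2026-08-31); third file (K3) of the seat's kernel
plan for the MIXED Lemma AE₃ (`work/s188/MIXED-AE3-note.md` §2 (f), §6).  For `Q ∈ ℤ[X]`,
`Q ≠ 0`, and a multiplicity threshold `e ≥ 1` there is an integer polynomial `F_e ≠ 0` with

* `F_e ^ e ∣ Q` — hence `e · deg F_e ≤ deg Q` and `M(F_e) ^ e ≤ M(Q)`
  (`e · log M(F_e) ≤ log M(Q)`);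
* every complex root of `Q` of multiplicity `≥ e` is a root of `F_e`

(`soloMC_exists_class_poly`, real-number form `soloMC_exists_class_poly_real`).  With
`e = 2^j` these are the dyadic classes of the seat's charging argument: a root of multiplicity
`m ∈ [2^j, 2^(j+1))` is a root of `F_(2^j)`, and the class weight `2^j` is compensated by
`2^j deg F_(2^j) ≤ deg Q`, `2^j log M(F_(2^j)) ≤ log M(Q)`.

Construction: `F_e := radical Q₀`, `Q₀ := primPart (gcd_{i<e} Q^{[i]})` (divided derivatives),
exactly D. Roy's radical-of-the-gcd-of-derivatives device already in the tree
(`SoloInformedDerivativeGcdRadical`, Part B: `soloDG_radical_pow_dvd`,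
`soloDG_mul_natDegree_radical_le`, `soloDG_mahlerMeasure_radical_pow_le`,
`soloDG_aeval_radical_eq_zero`), applied to `P = Q` itself.  The one new input is
`soloMC_aeval_primPart_gcd_eq_zero`: a complex root `z` of `Q` of multiplicity `≥ e` is a root
of `Q₀` — `z` is a root of `Q^{[i]}` for `i < e` (Mathlib's
`isRoot_iterate_derivative_of_lt_rootMultiplicity`), a prime factor `p ∈ ℤ[X]` of `Q` vanishing
at `z` is primitive and irreducible over `ℚ` (Gauss), so divides every integer polynomial
vanishing at `z` (`soloMC_factor_dvd_of_aeval_eq_zero`), hence the gcd and its primitive part.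

## Why (seat bookkeeping)

Toy layer only (node `RoyAdditiveDirichletExponent`, [cite: Roy2010, Thm 1.1], device of
[cite: Roy2010, §1 p. 4, step (3)]); nothing here bears on
`Literature.Periods.SchanuelConjecture`; the seat's verdict (no path) is unchanged.  No novelty
claimed; Mathlib + the seat files only; no definitions; no literature hypotheses; standard
axioms.
-/

namespace Summit.Schanuel.Schanuel.Theorems

open Polynomial Finset UniqueFactorizationMonoid

section Factors

/-- An irreducible rational polynomial sharing a complex root with `f` divides `f`. -/
theorem soloMC_dvd_of_aeval_eq_zero {p f : ℚ[X]} (hp : Irreducible p) {z : ℂ}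
    (hpz : aeval z p = 0) (hfz : aeval z f = 0) : p ∣ f := by
  rcases dvd_or_isCoprime p f hp with h | h
  · exact h
  · exfalso
    obtain ⟨u, v, huv⟩ := h
    have h1 := congrArg (aeval z) huv
    rw [map_add, map_mul, map_mul, hpz, hfz, mul_zero, mul_zero, add_zero, map_one] at h1
    exact zero_ne_one h1

/-- A prime factor (in `ℤ[X]`) of `Q ≠ 0` vanishing at a given complex root of `Q`. -/
theorem soloMC_exists_normalizedFactor_aeval_eq_zero {Q : ℤ[X]} (hQ : Q ≠ 0) {z : ℂ}
    (hz : aeval z Q = 0) : ∃ p ∈ normalizedFactors Q, aeval z p = 0 := by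
  obtain ⟨u, hu⟩ := prod_normalizedFactors hQ
  have h1 : aeval z ((normalizedFactors Q).prod * (u : ℤ[X])) = 0 := by rw [hu]; exact hz
  rw [map_mul, mul_eq_zero] at h1
  rcases h1 with h1 | h1
  · rw [map_multiset_prod, Multiset.prod_eq_zero_iff, Multiset.mem_map] at h1
    obtain ⟨p, hp, hpz⟩ := h1
    exact ⟨p, hp, hpz⟩
  · exfalso
    have h2 : aeval z ((u : ℤ[X]) * (↑u⁻¹ : ℤ[X])) = 1 := by rw [Units.mul_inv, map_one]
    rw [map_mul, h1, zero_mul] at h2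
    exact zero_ne_one h2

/-- A prime factor of an integer polynomial vanishing at `z ∈ ℂ` is primitive, and it divides
(in `ℤ[X]`) every integer polynomial vanishing at `z` (Gauss's lemma both ways). -/
theorem soloMC_factor_dvd_of_aeval_eq_zero {Q p : ℤ[X]} (hp : p ∈ normalizedFactors Q)
    {z : ℂ} (hpz : aeval z p = 0) :
    p.IsPrimitive ∧ ∀ f : ℤ[X], aeval z f = 0 → p ∣ f := by
  have hpirr : Irreducible p := irreducible_of_normalized_factor p hp
  have hp0 : p ≠ 0 := hpirr.ne_zero
  have hdeg : p.natDegree ≠ 0 := by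
    intro h
    have hpz' := hpz
    rw [eq_C_of_natDegree_eq_zero h, aeval_C, algebraMap_int_eq, eq_intCast,
      Int.cast_eq_zero] at hpz'
    apply hp0
    rw [eq_C_of_natDegree_eq_zero h, hpz', C_0]
  have hpprim : p.IsPrimitive := hpirr.isPrimitive hdeg
  refine ⟨hpprim, fun f hfz => ?_⟩
  have hpirr' : Irreducible (p.map (Int.castRingHom ℚ)) :=
    (IsPrimitive.Int.irreducible_iff_irreducible_map_cast hpprim).mp hpirr
  have hmapz : ∀ g : ℤ[X], aeval z (g.map (Int.castRingHom ℚ)) = aeval z g := by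
    intro g
    rw [← algebraMap_int_eq, aeval_map_algebraMap]
  have hdvd' := soloMC_dvd_of_aeval_eq_zero hpirr' (by rw [hmapz]; exact hpz)
    (by rw [hmapz]; exact hfz)
  exact (IsPrimitive.Int.dvd_iff_map_cast_dvd_map_cast p f hpprim).mpr hdvd'

end Factors

section Classes

/-- A complex root of `Q` of multiplicity `≥ e` is a root of the divided derivatives
`Q^{[j]}`, `j < e`. -/
theorem soloMC_aeval_hasseDeriv_eq_zero {Q : ℤ[X]} {e : ℕ} {z : ℂ}
    (hz : e ≤ rootMultiplicity z (Q.map (Int.castRingHom ℂ))) {j : ℕ} (hj : j < e) :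
    aeval z (hasseDeriv j Q) = 0 := by
  have h1 := isRoot_iterate_derivative_of_lt_rootMultiplicity (lt_of_lt_of_le hj hz)
  rw [iterate_derivative_map, soloDG_iterate_derivative_eq_factorial_smul, nsmul_eq_mul,
    Polynomial.map_mul, Polynomial.map_natCast, IsRoot.def, eval_mul, eval_natCast,
    mul_eq_zero] at h1
  rcases h1 with h1 | h1
  · exact absurd h1 (Nat.cast_ne_zero.mpr (Nat.factorial_ne_zero j))
  · rw [aeval_def, ← eval_map, algebraMap_int_eq]
    exact h1

/-- **The new input.**  `Q₀ := primPart (gcd_{i<e} Q^{[i]})` vanishes at every complex root of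
`Q ≠ 0` of multiplicity `≥ e` (`e ≥ 1`). -/
theorem soloMC_aeval_primPart_gcd_eq_zero {Q : ℤ[X]} (hQ : Q ≠ 0) {e : ℕ} (he : 1 ≤ e)
    {z : ℂ} (hz : e ≤ rootMultiplicity z (Q.map (Int.castRingHom ℂ))) :
    aeval z ((univ : Finset (Fin e)).gcd fun i => hasseDeriv (i : ℕ) Q).primPart = 0 := by
  have hQ' : Q.map (Int.castRingHom ℂ) ≠ 0 :=
    (Polynomial.map_ne_zero_iff Int.cast_injective).mpr hQ
  -- `z` is a root of `Q`
  have hz0 : aeval z Q = 0 := by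
    have h := ((rootMultiplicity_pos hQ').mp (lt_of_lt_of_le he hz))
    rw [IsRoot.def, eval_map, ← algebraMap_int_eq, ← aeval_def] at h
    exact h
  -- a prime factor of `Q` vanishing at `z` divides all `Q^{[j]}`, `j < e`, hence the gcd
  obtain ⟨p, hp, hpz⟩ := soloMC_exists_normalizedFactor_aeval_eq_zero hQ hz0
  obtain ⟨hpprim, hpdvd⟩ := soloMC_factor_dvd_of_aeval_eq_zero hp hpz
  have hpg : p ∣ (univ : Finset (Fin e)).gcd (fun i => hasseDeriv (i : ℕ) Q) :=
    Finset.dvd_gcd (fun i _ => hpdvd _ (soloMC_aeval_hasseDeriv_eq_zero hz i.2))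
  have hg0 : (univ : Finset (Fin e)).gcd (fun i => hasseDeriv (i : ℕ) Q) ≠ 0 := by
    intro h
    have h0 := Finset.gcd_eq_zero_iff.mp h ⟨0, he⟩ (Finset.mem_univ _)
    rw [show (((⟨0, he⟩ : Fin e) : ℕ)) = 0 from rfl, hasseDeriv_zero'] at h0
    exact hQ h0
  obtain ⟨c, hc⟩ := (IsPrimitive.dvd_primPart_iff_dvd hpprim hg0).mpr hpg
  rw [hc, map_mul, hpz, zero_mul]

/-- **Multiplicity classes.**  For `Q ≠ 0` in `ℤ[X]` and `e ≥ 1` there is `F ≠ 0` in `ℤ[X]`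
with `F ^ e ∣ Q`, `e · deg F ≤ deg Q`, `M(F) ^ e ≤ M(Q)`, vanishing at every complex root of
`Q` of multiplicity `≥ e` (`F = radical (primPart (gcd_{i<e} Q^{[i]}))`). -/
theorem soloMC_exists_class_poly (Q : ℤ[X]) (hQ : Q ≠ 0) {e : ℕ} (he : 1 ≤ e) :
    ∃ F : ℤ[X], F ≠ 0 ∧ F ^ e ∣ Q ∧ e * F.natDegree ≤ Q.natDegree ∧
      (F.map (Int.castRingHom ℂ)).mahlerMeasure ^ e ≤
        (Q.map (Int.castRingHom ℂ)).mahlerMeasure ∧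
      ∀ z : ℂ, e ≤ rootMultiplicity z (Q.map (Int.castRingHom ℂ)) → aeval z F = 0 := by
  obtain ⟨Q₀, hQ₀⟩ : ∃ Q₀ : ℤ[X],
      Q₀ = ((univ : Finset (Fin e)).gcd fun i => hasseDeriv (i : ℕ) Q).primPart := ⟨_, rfl⟩
  have hprim : Q₀.IsPrimitive := by rw [hQ₀]; exact isPrimitive_primPart _
  have hdvd : ∀ j < e, Q₀ ∣ hasseDeriv j Q := by
    intro j hj
    rw [hQ₀]
    exact soloDG_primPart_gcd_hasseDeriv_dvd Q e hj
  refine ⟨radical Q₀, radical_ne_zero, soloDG_radical_pow_dvd hprim hdvd,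
    soloDG_mul_natDegree_radical_le hprim hdvd hQ,
    soloDG_mahlerMeasure_radical_pow_le hprim hdvd hQ, fun z hz => ?_⟩
  refine soloDG_aeval_radical_eq_zero hprim.ne_zero ?_
  rw [hQ₀]
  exact soloMC_aeval_primPart_gcd_eq_zero hQ he hz

/-- **Multiplicity classes, real-number form** (as consumed by the mixed budget): `F ≠ 0`,
`e · deg F ≤ deg Q`, `e · log M(F) ≤ log M(Q)`, and the roots of multiplicity `≥ e`. -/
theorem soloMC_exists_class_poly_real (Q : ℤ[X]) (hQ : Q ≠ 0) {e : ℕ} (he : 1 ≤ e) :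
    ∃ F : ℤ[X], F ≠ 0 ∧ (e : ℝ) * F.natDegree ≤ Q.natDegree ∧
      (e : ℝ) * Real.log (F.map (Int.castRingHom ℂ)).mahlerMeasure ≤
        Real.log (Q.map (Int.castRingHom ℂ)).mahlerMeasure ∧
      ∀ z : ℂ, e ≤ rootMultiplicity z (Q.map (Int.castRingHom ℂ)) → aeval z F = 0 := by
  obtain ⟨F, hF0, -, hdeg, hM, hroots⟩ := soloMC_exists_class_poly Q hQ he
  refine ⟨F, hF0, by exact_mod_cast hdeg, ?_, hroots⟩
  have hF' : F.map (Int.castRingHom ℂ) ≠ 0 :=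
    (Polynomial.map_ne_zero_iff Int.cast_injective).mpr hF0
  rw [← Real.log_pow]
  exact Real.log_le_log (pow_pos (mahlerMeasure_pos_of_ne_zero hF') _) hM

end Classes

end Summit.Schanuel.Schanuel.Theorems
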